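import Literature.Probability.RandomPlanarGeometry.SAWWeightedAutomata
import Literature.Probability.RandomPlanarGeometry.SAWFiniteMemory
import Literature.Probability.RandomPlanarGeometry.SAWWordBridges
import Literature.Probability.RandomPlanarGeometry.BDGS2012
import Mathlib.Analysis.SpecialFunctions.Pow.Real
import HarnessLib

/-!
# Tilted Pönitz–Tittmann certificates: explicit exponential bounds on ballistic self-avoiding walks

Topic `Literature/Probability/RandomPlanarGeometry` (continues `SAWFiniteMemory.lean` and
`SAWWeightedAutomata.lean`). Duminil-Copin and Hammond (2013, Theorem 1.1) prove that the
self-avoiding walk on `ℤ^d` is sub-ballistic: for every `v > 0` there is `ε > 0` with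
`P_{SAW_n}(max_k ‖γ_k‖ ≥ vn) ≤ e^{-εn}` for `n` large — with NO explicit `ε`. For speeds `v`
above a threshold `v₀ ≈ 0.4` an explicit rate follows from a CHERNOFF bound through the memory-`K`
automaton of Pönitz–Tittmann with TILTED letter weights: with `r = a/b > 1` and weights
`W(±e₀) = (ab) r^{±1}`, `W(±e₁) = ab` (`tiltW a b`), every self-avoiding word survives the
automaton (`FiniteMemory.run_ne_none_of_isSAW`), so by the weighted Collatz–Wielandt lemma
(`WordAutomaton.sum_sawWords_wprod_mul_pow_le`)
`Σ_{SAW ω, |ω| = n} r^{x(ω_n)} (ab)^n ≤ (N/D)^n 2^{41}` whenever the weighted certificate check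
succeeds with ratio `N/D`, and Markov's inequality in `r^{x}` gives
`#{ω ∈ SAW_n : x(ω_n) ≥ m} ≤ 2^{41} (N/(Dab))^n (b/a)^m`.

* `FiniteMemory.wts / tiltW / tiltD` — letter weights (general; axis tilt; diagonal tilt);
* `FiniteMemory.checkT K w0 w1 w2 w3 N D iters` (and `checkW`, `checkD`) — executable weighted
  certificate check: the tree's untrusted breadth-first search `bfs K`, a weighted integer power
  iteration, and the verified `verifyW` (closure + `D·Σ_d W(d) v(ptStep a d) ≤ N·v(a)`);
* `certificateW_of_verifyW` (soundness), `sum_sawWords_wts_mul_pow_le_of_checkT`;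
* `wprod_tiltW_eq` — `Π_i tiltW(w_i) = (ab)^{|w|} (a/b)^{x(w)}`;
* **`card_sawWords_xEnd_ge_le`** — `#{w ∈ sawWords n : x(w) ≥ m} ≤ 2^{41}(N/(Dab))^n(b/a)^m`;
* `card_saws_filter_eq_card_sawWords_filter` — the same event over `Zd.saws 2 n`;
* **`card_ballistic_le_of_checkW`** — for ANY certified `0 < μlo ≤ μ(ℤ²)` and every real `v`, `n`:
  `#{ω ∈ SAW_n : x(ω_n) ≥ vn} ≤ 2^{41} e^{-ε n} cₙ`, `ε = v log(a/b) - log(N/(D a b μlo))`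
  (`cₙ ≥ μⁿ ≥ μloⁿ`, `Zd.pow_connectiveConstant_le_count`).
The evaluations `checkW 16 a b N D 60 = true` (one `native_decide` per tilt) and the resulting
explicit rates are in `SAWTiltedFiniteMemory16*.lean` / `SAWSubBallisticExplicit.lean`.

## References

* H. Duminil-Copin, A. Hammond, *Self-avoiding walk is sub-ballistic*, Commun. Math. Phys. 324
  (2013) 401–423, Theorem 1.1 and §2.4 (arXiv:1205.0401) [DuminilCopinHammond2013].
* A. Pönitz, P. Tittmann, *Improved upper bounds for self-avoiding walks in ℤᵈ*, Electron. J.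
  Combin. 7 (2000) R21, §2–3 [PonitzTittmann2000].
* N. Madras, G. Slade, *The Self-Avoiding Walk* (1993), §1.1 (walks as step sequences) [MadrasSlade1993].
-/

open Finset Filter Topology Literature.Probability.LatticeModels
open scoped BigOperators

namespace Literature.Probability.RandomPlanarGeometry.SAW

namespace FiniteMemory

/-! ### The tilted letter weights -/

/-- Four letter weights as a function on the step alphabet (`0 ↦ +e₀, 1 ↦ +e₁, 2 ↦ -e₀, 3 ↦ -e₁`).
[cite: PonitzTittmann2000, §3] -/
def wts (w0 w1 w2 w3 : ℕ) (d : Step) : ℕ :=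
  if d = 0 then w0 else if d = 1 then w1 else if d = 2 then w2 else w3

/-- The tilt weights with rational tilt `r = a/b` along the first axis, cleared of denominators:
`W(+e₀) = a²`, `W(-e₀) = b²`, `W(±e₁) = ab`, i.e. `W(d) = ab · r^{dx d}`.
[cite: DuminilCopinHammond2013, §2.4] -/
def tiltW (a b : ℕ) : Step → ℕ := wts (a * a) (a * b) (b * b) (a * b)

/-- The DIAGONAL tilt weights `W(d) = ab · r^{dx d + dy d}`: `W(+e₀) = W(+e₁) = a²`,
`W(-e₀) = W(-e₁) = b²`. [cite: DuminilCopinHammond2013, §2.4] -/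
def tiltD (a b : ℕ) : Step → ℕ := wts (a * a) (a * a) (b * b) (b * b)

/-! ### The tilted certificate: untrusted search -/

/-- Weighted successor table: for every state the list of (letter weight, successor index)
(untrusted). [cite: PonitzTittmann2000, §3] -/
def transTableW (K : ℕ) (W : Step → ℕ) (states : Array (List Step)) (idx : Std.HashMap (List Step) ℕ) :
    Array (Array (ℕ × ℕ)) :=
  states.map fun a => Id.run do
    let mut acc : Array (ℕ × ℕ) := #[]
    for d in List.finRange 4 do
      match ptStep K a d with
      | none => pure ()
      | some b => acc := acc.push (W d, idx.getD b 0)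
    return acc

/-- Weighted integer power iteration towards the Perron eigenvector of the tilted automaton,
normalised to `max ≈ 2⁴⁰`, entries `≥ 1` (untrusted). [cite: PonitzTittmann2000, §3] -/
def powerIterW (T : Array (Array (ℕ × ℕ))) (iters : ℕ) : Array ℕ := Id.run do
  let n := T.size
  let mut v : Array ℕ := Array.replicate n (2 ^ 20)
  for _ in [0:iters] do
    let mut w : Array ℕ := Array.replicate n 0
    let mut mx : ℕ := 1
    for i in [0:n] do
      let s := (T[i]!).foldl (fun acc p => acc + p.1 * v[p.2]!) 0
      w := w.set! i s
      if s > mx then mx := s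
    v := w.map fun s => s * 2 ^ 40 / mx + 1
  return v

/-- The tilted search: states, index, proposed weights (untrusted). [cite: PonitzTittmann2000, §3] -/
def searchW (K : ℕ) (W : Step → ℕ) (iters : ℕ) :
    Array (List Step) × Std.HashMap (List Step) ℕ × Array ℕ :=
  let (states, idx) := bfs K
  (states, idx, powerIterW (transTableW K W states idx) iters)

/-! ### The tilted certificate: verified check -/

/-- Check of the state number `i` for the WEIGHTED Collatz–Wielandt inequality
`D · Σ_d W(d) v(ptStep a d) ≤ N · v(a)` (plus index consistency, positivity, closure).
[cite: PonitzTittmann2000, §3] -/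
def verifyStateW (K : ℕ) (W : Step → ℕ) (N D : ℕ) (states : Array (List Step))
    (idx : Std.HashMap (List Step) ℕ) (v : Array ℕ) (i : ℕ) : Bool :=
  match states[i]?, v[i]? with
  | some a, some vi =>
    decide (idx[a]? = some i) && decide (1 ≤ vi) &&
      (List.finRange 4).all (fun d =>
        match ptStep K a d with
        | none => true
        | some b =>
          match idx[b]? with
          | none => false
          | some j => decide (states[j]? = some b)) &&
      decide (D * (List.ofFn fun d : Step => W d * ((ptStep K a d).map (weightOf idx v)).getD 0).sum
        ≤ N * vi)
  | _, _ => false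

/-- The verified part of the tilted certificate check. [cite: PonitzTittmann2000, §3] -/
def verifyW (K : ℕ) (W : Step → ℕ) (N D : ℕ) (states : Array (List Step))
    (idx : Std.HashMap (List Step) ℕ) (v : Array ℕ) : Bool :=
  decide (states[0]? = some []) && decide (weightOf idx v [] ≤ 2 ^ 41) &&
    (List.range states.size).all (verifyStateW K W N D states idx v)

/-- **The weighted certificate check** `checkT K w0 w1 w2 w3 N D iters` for the letter weights
`(w0, w1, w2, w3)`: search, then verify. Only ever evaluated by `native_decide`.
[cite: PonitzTittmann2000, §3] -/
@[irreducible] def checkT (K w0 w1 w2 w3 N D iters : ℕ) : Bool :=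
  let r := searchW K (wts w0 w1 w2 w3) iters
  verifyW K (wts w0 w1 w2 w3) N D r.1 r.2.1 r.2.2

/-- **The axis-tilted check** (tilt `r = a/b` along the first axis). [cite: PonitzTittmann2000, §3] -/
def checkW (K a b N D iters : ℕ) : Bool := checkT K (a * a) (a * b) (b * b) (a * b) N D iters

/-- **The diagonally tilted check** (tilt `r = a/b` along `e₀ + e₁`). [cite: PonitzTittmann2000, §3] -/
def checkD (K a b N D iters : ℕ) : Bool := checkT K (a * a) (a * a) (b * b) (b * b) N D iters

/-- Telemetry for choosing `N/D` (untrusted, never used in proofs): the state count and the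
largest weighted Collatz–Wielandt ratio `⌈max_a Σ_d W(d) v(succ)/v(a)⌉` scaled by `10⁶`.
[cite: PonitzTittmann2000, §3] -/
def ratioT (K w0 w1 w2 w3 iters : ℕ) : ℕ × ℕ := Id.run do
  let r := searchW K (wts w0 w1 w2 w3) iters
  let states := r.1
  let idx := r.2.1
  let v := r.2.2
  let mut worst : ℕ := 0
  for i in [0:states.size] do
    let a0 := states[i]!
    let s := (List.ofFn fun d : Step => wts w0 w1 w2 w3 d * ((ptStep K a0 d).map (weightOf idx v)).getD 0).sum
    let q := (s * 1000000 + v[i]! - 1) / v[i]!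
    if q > worst then worst := q
  return (states.size, worst)

/-! ### Soundness of the tilted check -/

/-- **Soundness of `verifyW`**: a successful check yields a weighted Collatz–Wielandt certificate
for `ptStep K` on the tabulated states, with `v([]) ≤ 2⁴¹`. [cite: PonitzTittmann2000, §3] -/
theorem certificateW_of_verifyW {K N D : ℕ} {W : Step → ℕ} {states : Array (List Step)}
    {idx : Std.HashMap (List Step) ℕ} {v : Array ℕ} (h : verifyW K W N D states idx v = true) :
    WordAutomaton.CertificateW (ptStep K) {a | ∃ i < states.size, states[i]? = some a}
      (weightOf idx v) W N D ∧ weightOf idx v [] ≤ 2 ^ 41 := by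
  simp only [verifyW, Bool.and_eq_true, decide_eq_true_eq, List.all_eq_true, List.mem_range] at h
  obtain ⟨⟨h0, hroot⟩, hall⟩ := h
  have key : ∀ a : List Step, ∀ i < states.size, states[i]? = some a →
      idx[a]? = some i ∧ 1 ≤ weightOf idx v a ∧
      (∀ d b, ptStep K a d = some b → ∃ j < states.size, states[j]? = some b) ∧
      D * ∑ d : Step, W d * ((ptStep K a d).map (weightOf idx v)).getD 0 ≤ N * weightOf idx v a := by
    intro a i hi ha
    have hs := hall i hi
    unfold verifyStateW at hs
    rw [ha] at hs
    cases hv : v[i]? with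
    | none => simp [hv] at hs
    | some vi =>
      simp only [hv, Bool.and_eq_true, decide_eq_true_eq, List.all_eq_true] at hs
      obtain ⟨⟨⟨hidx, hvi⟩, hsucc⟩, hcw⟩ := hs
      have hw : weightOf idx v a = vi := by simp [weightOf, hidx, hv]
      refine ⟨hidx, hw ▸ hvi, fun d b hb => ?_, ?_⟩
      · have := hsucc d (List.mem_finRange d)
        rw [hb] at this
        cases hj : idx[b]? with
        | none => simp [hj] at this
        | some j =>
          simp only [hj, decide_eq_true_eq] at this
          exact ⟨j, (Array.getElem?_eq_some_iff.1 this).1, this⟩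
      · rw [hw, ← List.sum_ofFn]
        exact hcw
  refine ⟨⟨?_, ?_, ?_, ?_⟩, hroot⟩
  · exact ⟨0, (Array.getElem?_eq_some_iff.1 h0).1, h0⟩
  · rintro a ⟨i, hi, ha⟩ d b hb
    exact (key a i hi ha).2.2.1 d b hb
  · rintro a ⟨i, hi, ha⟩
    exact (key a i hi ha).2.1
  · rintro a ⟨i, hi, ha⟩
    exact (key a i hi ha).2.2.2

/-- **The tilted self-avoiding count from a successful check**:
`(Σ_{w ∈ sawWords n} Π tiltW(w_i)) · Dⁿ ≤ Nⁿ · 2⁴¹`. [cite: PonitzTittmann2000, §3] -/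
theorem sum_sawWords_wts_mul_pow_le_of_checkT {K w0 w1 w2 w3 N D iters : ℕ}
    (h : checkT K w0 w1 w2 w3 N D iters = true) (n : ℕ) :
    (∑ w ∈ sawWords n, WordAutomaton.wprod (wts w0 w1 w2 w3) w) * D ^ n ≤ N ^ n * 2 ^ 41 := by
  rw [checkT] at h
  obtain ⟨hc, hroot⟩ := certificateW_of_verifyW h
  exact le_trans (WordAutomaton.sum_sawWords_wprod_mul_pow_le hc (run_ne_none_of_isSAW K) n)
    (Nat.mul_le_mul_left _ hroot)

/-- The axis-tilted count from `checkW`. [cite: PonitzTittmann2000, §3] -/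
theorem sum_sawWords_tiltW_mul_pow_le_of_checkW {K a b N D iters : ℕ} (h : checkW K a b N D iters = true)
    (n : ℕ) : (∑ w ∈ sawWords n, WordAutomaton.wprod (tiltW a b) w) * D ^ n ≤ N ^ n * 2 ^ 41 :=
  sum_sawWords_wts_mul_pow_le_of_checkT h n

/-! ### The tilt weight of a word is `(ab)^{|w|} (a/b)^{x(w)}` -/

/-- The endpoint abscissa of a `cons`. [folklore] -/
private theorem xEnd_cons (d : Step) (w : List Step) : xEnd (d :: w) = Step.dx d + xEnd w := by
  simp only [xEnd, xAt, traj_length, wEnd_cons, Pi.add_apply, Step.vec_apply_zero]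

/-- The endpoint abscissa of the empty word. [folklore] -/
private theorem xEnd_nil : xEnd ([] : List Step) = 0 := by
  simp [xEnd, xAt]

/-- **`Π_i tiltW(w_i) = (ab)^{|w|} · (a/b)^{x(w)}`** (as reals, `a, b > 0`).
[cite: DuminilCopinHammond2013, §2.4] -/
theorem wprod_tiltW_eq {a b : ℕ} (ha : 0 < a) (hb : 0 < b) (w : List Step) :
    (WordAutomaton.wprod (tiltW a b) w : ℝ) = ((a : ℝ) * b) ^ w.length * ((a : ℝ) / b) ^ (xEnd w) := by
  have ha' : (a : ℝ) ≠ 0 := by positivity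
  have hb' : (b : ℝ) ≠ 0 := by positivity
  have hq : (a : ℝ) / b ≠ 0 := div_ne_zero ha' hb'
  induction w with
  | nil => simp [xEnd_nil]
  | cons d w ih =>
    rw [WordAutomaton.wprod_cons, Nat.cast_mul, ih, xEnd_cons, zpow_add₀ hq, List.length_cons, pow_succ]
    have hd : (tiltW a b d : ℝ) = (a : ℝ) * b * ((a : ℝ) / b) ^ (Step.dx d) := by
      fin_cases d <;> simp [tiltW, wts, Step.dx] <;> field_simp
    rw [hd]; ring

/-! ### Chernoff: the number of tilted-favourable self-avoiding words -/

/-- **Exponential tilting bound on the word count**: from a successful tilted check with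
`0 < b ≤ a`, for every length `n` and every integer level `m`,
`#{w ∈ sawWords n : x(w) ≥ m} ≤ 2⁴¹ · (N/(D·a·b))ⁿ · (b/a)^m`.
[cite: DuminilCopinHammond2013, §2.4] -/
theorem card_sawWords_xEnd_ge_le {K a b N D iters : ℕ} (h : checkW K a b N D iters = true)
    (hb : 0 < b) (hba : b ≤ a) (hD : 0 < D) (n : ℕ) (m : ℤ) :
    (((sawWords n).filter fun w => m ≤ xEnd w).card : ℝ) ≤
      2 ^ 41 * ((N : ℝ) / (D * a * b)) ^ n * ((b : ℝ) / a) ^ m := by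
  have ha : 0 < a := lt_of_lt_of_le hb hba
  have hab0 : (0 : ℝ) < (a : ℝ) * b := by positivity
  have hr1 : (1 : ℝ) ≤ (a : ℝ) / b := by
    rw [le_div_iff₀ (by exact_mod_cast hb), one_mul]; exact_mod_cast hba
  have hr0 : (0 : ℝ) < (a : ℝ) / b := by positivity
  set F := (sawWords n).filter fun w => m ≤ xEnd w with hF
  -- the filtered words have weight ≥ (ab)^n (a/b)^m each
  have hlow : (F.card : ℝ) * (((a : ℝ) * b) ^ n * ((a : ℝ) / b) ^ m) ≤
      ∑ w ∈ sawWords n, (WordAutomaton.wprod (tiltW a b) w : ℝ) := by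
    calc (F.card : ℝ) * (((a : ℝ) * b) ^ n * ((a : ℝ) / b) ^ m)
        = ∑ w ∈ F, ((a : ℝ) * b) ^ n * ((a : ℝ) / b) ^ m := by rw [sum_const, nsmul_eq_mul]
      _ ≤ ∑ w ∈ F, (WordAutomaton.wprod (tiltW a b) w : ℝ) := by
          refine sum_le_sum fun w hw => ?_
          rw [hF, mem_filter, mem_sawWords] at hw
          rw [wprod_tiltW_eq ha hb, hw.1.1]
          exact mul_le_mul_of_nonneg_left (zpow_le_zpow_right₀ hr1 hw.2) (pow_nonneg hab0.le _)
      _ ≤ ∑ w ∈ sawWords n, (WordAutomaton.wprod (tiltW a b) w : ℝ) :=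
          sum_le_sum_of_subset_of_nonneg (filter_subset _ _) fun _ _ _ => Nat.cast_nonneg _
  -- the total weight is ≤ Nⁿ 2⁴¹ / Dⁿ
  have hup : (∑ w ∈ sawWords n, (WordAutomaton.wprod (tiltW a b) w : ℝ)) * (D : ℝ) ^ n ≤
      (N : ℝ) ^ n * 2 ^ 41 := by
    have := sum_sawWords_tiltW_mul_pow_le_of_checkW h n
    exact_mod_cast this
  have hDn : (0 : ℝ) < (D : ℝ) ^ n := by positivity
  have hpos : (0 : ℝ) < ((a : ℝ) * b) ^ n * ((a : ℝ) / b) ^ m :=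
    mul_pos (pow_pos hab0 _) (zpow_pos hr0 _)
  -- combine
  have key : (F.card : ℝ) * (((a : ℝ) * b) ^ n * ((a : ℝ) / b) ^ m) * (D : ℝ) ^ n ≤ (N : ℝ) ^ n * 2 ^ 41 :=
    le_trans (mul_le_mul_of_nonneg_right hlow hDn.le) hup
  have hrew : 2 ^ 41 * ((N : ℝ) / (D * a * b)) ^ n * ((b : ℝ) / a) ^ m =
      (N : ℝ) ^ n * 2 ^ 41 / ((((a : ℝ) * b) ^ n * ((a : ℝ) / b) ^ m) * (D : ℝ) ^ n) := by
    rw [div_pow, show ((b : ℝ) / a) = ((a : ℝ) / b)⁻¹ by rw [inv_div], inv_zpow]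
    field_simp
    ring
  rw [hrew, le_div_iff₀ (mul_pos hpos hDn), ← mul_assoc]
  exact key

/-! ### The same count in the vertex-function vocabulary `Zd.saws 2 n` -/

/-- The endpoint abscissa of a word is the first coordinate of the last vertex of its trajectory.
[folklore] -/
private theorem xEnd_eq_traj (w : List Step) : xEnd w = traj w w.length 0 := rfl

/-- **Word/vertex-function dictionary for the tilted event**:
`#{ω ∈ SAW_n : m ≤ x(ω_n)} = #{w ∈ sawWords n : m ≤ x(w)}`. [cite: MadrasSlade1993, §1.1] -/
theorem card_saws_filter_eq_card_sawWords_filter (n : ℕ) (m : ℤ) :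
    ((Zd.saws 2 n).filter fun ω => m ≤ ω n 0).card = ((sawWords n).filter fun w => m ≤ xEnd w).card := by
  classical
  rw [← image_traj_sawWords, filter_image, card_image_of_injOn]
  · congr 1
    ext w
    simp only [mem_filter, mem_sawWords, xEnd_eq_traj, and_congr_right_iff]
    rintro ⟨hl, -⟩; rw [hl]
  · intro w hw w' hw' h
    simp only [coe_filter, Set.mem_setOf_eq, mem_sawWords] at hw hw'
    exact eq_of_traj_eq (by rw [hw.1.1, hw'.1.1]) h

/-- **Explicit exponential bound on the ballistic event along an axis.** From a successful tilted
check `checkW K a b N D iters` (`0 < b < a`, `0 < D`) and ANY certified lower bound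
`0 < μlo ≤ μ(ℤ²)`: for every real `v` and every `n`,
`#{ω ∈ SAW_n : x(ω_n) ≥ v n} ≤ 2⁴¹ · exp(-ε n) · cₙ` with the explicit rate
`ε = v · log(a/b) - log(N / (D a b μlo))` (positive iff `(a/b)^v μlo > N/(D a b)`, the certified
tilted growth rate). [cite: DuminilCopinHammond2013, Thm 1.1] -/
theorem card_ballistic_le_of_checkW {K a b N D iters : ℕ} (h : checkW K a b N D iters = true)
    (hb : 0 < b) (hba : b < a) (hD : 0 < D) (hN : 0 < N) {μlo : ℝ} (hμ0 : 0 < μlo)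
    (hμ : μlo ≤ Zd.connectiveConstant 2) (v : ℝ) (n : ℕ) :
    (((Zd.saws 2 n).filter fun ω => v * n ≤ ((ω n 0 : ℤ) : ℝ)).card : ℝ) ≤
      2 ^ 41 * Real.exp (-((v * Real.log ((a : ℝ) / b) - Real.log ((N : ℝ) / (D * a * b) / μlo)) * n)) *
        Zd.count 2 n := by
  have ha : 0 < a := lt_trans hb hba
  have hr0 : (0 : ℝ) < (a : ℝ) / b := by positivity
  have hs0 : (0 : ℝ) < (b : ℝ) / a := by positivity
  have hs1 : (b : ℝ) / a ≤ 1 := by rw [div_le_one (by exact_mod_cast ha)]; exact_mod_cast hba.le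
  have hl0 : (0 : ℝ) < (N : ℝ) / (D * a * b) := by positivity
  -- integer level `m = ⌈v n⌉`
  set m : ℤ := ⌈v * n⌉ with hm
  have hev : ((Zd.saws 2 n).filter fun ω => v * n ≤ ((ω n 0 : ℤ) : ℝ)) =
      (Zd.saws 2 n).filter fun ω => m ≤ ω n 0 := by
    refine filter_congr fun ω _ => ?_
    rw [hm, Int.ceil_le]
  rw [hev, card_saws_filter_eq_card_sawWords_filter]
  refine le_trans (card_sawWords_xEnd_ge_le h hb hba.le hD n m) ?_
  -- `(b/a)^m ≤ (b/a)^{vn}` and `(N/(Dab))ⁿ (b/a)^{vn} = e^{-εn} μloⁿ ≤ e^{-εn} cₙ`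
  have h1 : ((b : ℝ) / a) ^ m ≤ ((b : ℝ) / a) ^ (v * n : ℝ) := by
    rw [← Real.rpow_intCast]
    exact Real.rpow_le_rpow_of_exponent_ge hs0 hs1 (hm ▸ Int.le_ceil _)
  have hμn : μlo ^ n ≤ (Zd.count 2 n : ℝ) :=
    le_trans (pow_le_pow_left₀ hμ0.le hμ n) (Zd.pow_connectiveConstant_le_count 2 n)
  have hexp : ((N : ℝ) / (D * a * b)) ^ n * ((b : ℝ) / a) ^ (v * n : ℝ) =
      Real.exp (-((v * Real.log ((a : ℝ) / b) - Real.log ((N : ℝ) / (D * a * b) / μlo)) * n)) * μlo ^ n := by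
    rw [Real.rpow_def_of_pos hs0, ← Real.exp_log (pow_pos hl0 n), ← Real.exp_log (pow_pos hμ0 n),
      ← Real.exp_add, ← Real.exp_add, Real.log_pow, Real.log_pow, Real.log_div hl0.ne' hμ0.ne',
      show Real.log ((b : ℝ) / a) = -Real.log ((a : ℝ) / b) by
        rw [← Real.log_inv, inv_div]]
    congr 1; ring
  calc 2 ^ 41 * ((N : ℝ) / (D * a * b)) ^ n * ((b : ℝ) / a) ^ m
      ≤ 2 ^ 41 * ((N : ℝ) / (D * a * b)) ^ n * ((b : ℝ) / a) ^ (v * n : ℝ) := by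
        gcongr
    _ = 2 ^ 41 * Real.exp (-((v * Real.log ((a : ℝ) / b) - Real.log ((N : ℝ) / (D * a * b) / μlo)) * n)) *
          μlo ^ n := by rw [mul_assoc, hexp, ← mul_assoc]
    _ ≤ _ := by gcongr

end FiniteMemory

end Literature.Probability.RandomPlanarGeometry.SAW
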